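import Summits.PneNP.PneNP.Theorems.ChebyshevTracialDesignCrossingCountTails
import HarnessLib

/-!
# Cell pnp-psdrank, route `ChebyshevTracialDesign`: BOTH TAILS OF THE CROSSING-COUNT LAW OF A UNIFORM PERFECT MATCHING, part B —
# the explicit `2^{−a₀}` tails and the `PMatch n` forms (crux `TracialDecayExp20`, stmt-PneNP-19878)

Engine brick (eng g20), part B of two (part A = `…CrossingCountTails`: ratio of consecutive classes `N(b)·(h−b)(h'−b) = N(b+2)·(b+1)(b+2)`,
comparison steps, iterates, tails under arithmetic hypotheses). Notation as there: `U ⊆ S`, `h = |U|`, `h' = |S ∖ U|`,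
`cr(U,M) = #{e ∈ M | cutCount U e = 1}` [cite: Rothvoss2017, §2 (PDF p. 5)], `N(b) = #{M ∈ PM(S) | cr(U,M) = b}`. Here `ρ = 1/4`:
* §5 **`card_filter_cr_le_le_half_pow`** — `9a₀ + 1 ≤ min(h, h')` ⟹ `#{M ∈ PM(S) : cr(U,M) ≤ a₀} ≤ 2^{−a₀}·#PM(S)` (few crossing
  edges: for `b < 3a₀` both `h − b`, `h' − b` are `≥ 2(b+2)`, then `(a₀+1)4^{−a₀} ≤ 2^{−a₀}`);
  **`card_filter_card_le_cr_add_le_half_pow`** — `h = h'`, `9(a₀+1) ≤ h` ⟹ `#{M ∈ PM(S) : h ≤ cr(U,M) + a₀} ≤ 2^{−a₀}·#PM(S)` (few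
  NON-crossing edges; for `h = h'` the `(U,M)`-type `(a,b,d) = ((h−b)/2, b, (h'−b)/2)` has `a = d`, so this is the second way for both
  same-side edge classes to be small — e.g. `U` a transversal of `M`, where the shell law of `|U' ∩ U|` is `s + Bin(c, ½)`, rough at `c = 1`);
* §6 the `PMatch n` forms in Rothvoß's `Crosses` vocabulary: **`card_pmatch_crosses_le_le`** (`9a₀+1 ≤ |H|, n − |H|` ⟹
  `#{M : PMatch n | #{e ∈ M : Crosses H e} ≤ a₀} ≤ 2^{−a₀}·|PMatch n|`) and **`card_pmatch_le_crosses_le`** (`n − |H| = |H| ≥ 9(a₀+1)` ⟹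
  `#{M : PMatch n | |H| ≤ #{e ∈ M : Crosses H e} + a₀} ≤ 2^{−a₀}·|PMatch n|`).
* §7 (v2) **`card_filter_card_le_cr_add_le_half_pow_near`** / **`card_pmatch_le_crosses_le_near`** — the upper tail for NEAR-balanced
  blocks `|S ∖ U| = |U| + e`, `9(a₀+1) + 2e ≤ |U|` (for `e > 2a₀` the event «both same-side classes ≤ a₀/2» is empty).
USE (LIT-44 §3(b)/§5 (e4), LIT-45 §2, prover MEMO-23 §7): the ALIGNED exceptional set of matchings in the per-matching pricing of
`H`-symmetric masks (`b_M(H) < βN`, or `> (1−β)N` when `|H| = n/2`) has mass `≤ 2^{−βN}` for `β ≤ 1/9` (up to the `+1`'s).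
[cite: Rothvoss2017, §2 (PDF p. 5)] [folklore]
Stature: support/instrument (kernel lane: no definitions, axioms standard). WHAT THIS IS NOT: nothing on the design value, no proof or
refutation of `TracialDecayExp20`, nothing on the psd rank of `P_PM(K_n)`, no P-vs-NP content. Supports stmt-PneNP-19878.
-/

set_option linter.dupNamespace false -- `Summit.PneNP.PneNP.…`: summit = sub-problem (D-0017)

namespace Summit.PneNP.PneNP.Theorems.ChebyshevTracialDesignCrossingCountTailsExplicit

open Finset Literature.Barriers.PneNP Literature.Combinatorics.SimpleGraph.CycleSpace
open Summit.PneNP.PneNP.Theorems.ChebyshevTracialDesignJunta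
open Summit.PneNP.PneNP.Theorems.ChebyshevTracialDesignClosedPairCount (card_filter_pmatch)
open Summit.PneNP.PneNP.Theorems.ChebyshevTracialDesignCrossingCountTails

section General

variable {V : Type*} [DecidableEq V]

/-! ### §5 The `ρ = 1/4` instances -/

/-- **LOWER TAIL, explicit**: if `9a₀ + 1 ≤ |U|` and `9a₀ + 1 ≤ |S ∖ U|`, then
`#{M ∈ PM(S) : cr(U,M) ≤ a₀} ≤ 2^{−a₀}·#PM(S)` — perfect matchings with fewer than `min(|U|,|S∖U|)/9` edges crossing `U` are an
exponentially small fraction. (`ρ = 1/4`, `m = a₀`: for `b < 3a₀` both `|U| − b` and `|S∖U| − b` are `≥ 2(b+2)`.)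
[cite: Rothvoss2017, §2 (PDF p. 5)] [folklore] -/
theorem card_filter_cr_le_le_half_pow {S U : Finset V} (hU : U ⊆ S) {a₀ : ℕ}
    (hh : 9 * a₀ + 1 ≤ U.card) (hh' : 9 * a₀ + 1 ≤ (S \ U).card) :
    ((((perfectMatchings S).filter fun M => (M.filter fun e => cutCount U e = 1).card ≤ a₀).card : ℕ) : ℝ) ≤
      (1 / 2 : ℝ) ^ a₀ * ((perfectMatchings S).card : ℝ) := by
  have hyp : ∀ b : ℕ, b < a₀ + 2 * a₀ →
      ((b : ℝ) + 1) * ((b : ℝ) + 2) ≤ (1 / 4 : ℝ) * (((U.card - b : ℕ) : ℝ) * (((S \ U).card - b : ℕ) : ℝ)) := by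
    intro b hb
    have h1 : 2 * (b + 2) ≤ U.card - b := by omega
    have h2 : 2 * (b + 2) ≤ (S \ U).card - b := by omega
    have h1R : (2 : ℝ) * ((b : ℝ) + 2) ≤ ((U.card - b : ℕ) : ℝ) := by exact_mod_cast h1
    have h2R : (2 : ℝ) * ((b : ℝ) + 2) ≤ (((S \ U).card - b : ℕ) : ℝ) := by exact_mod_cast h2
    have hprod : (2 * ((b : ℝ) + 2)) * (2 * ((b : ℝ) + 2)) ≤
        ((U.card - b : ℕ) : ℝ) * (((S \ U).card - b : ℕ) : ℝ) :=
      mul_le_mul h1R h2R (by positivity) (by positivity)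
    have hb0 : (0 : ℝ) ≤ (b : ℝ) := Nat.cast_nonneg b
    nlinarith
  -- `(a₀+1)·4^{−a₀} ≤ 2^{−a₀}` (the tree's `Literature.Computability.Cryptography.PowerSeriesFP.succ_mul_quarter_pow_le`, inlined
  -- to keep this file's imports inside the route)
  have hq : ((a₀ : ℝ) + 1) * (1 / 4 : ℝ) ^ a₀ ≤ (1 / 2 : ℝ) ^ a₀ := by
    have h2 : (a₀ : ℝ) + 1 ≤ 2 ^ a₀ := by exact_mod_cast Nat.lt_two_pow_self
    have e : (1 / 4 : ℝ) ^ a₀ = (1 / 2 : ℝ) ^ a₀ * (1 / 2 : ℝ) ^ a₀ := by rw [← mul_pow]; norm_num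
    have hh2 : (0 : ℝ) ≤ (1 / 2 : ℝ) ^ a₀ := by positivity
    have h1 : ((a₀ : ℝ) + 1) * (1 / 2 : ℝ) ^ a₀ ≤ 1 :=
      calc ((a₀ : ℝ) + 1) * (1 / 2 : ℝ) ^ a₀ ≤ 2 ^ a₀ * (1 / 2 : ℝ) ^ a₀ := mul_le_mul_of_nonneg_right h2 hh2
        _ = 1 := by rw [← mul_pow]; norm_num
    calc ((a₀ : ℝ) + 1) * (1 / 4 : ℝ) ^ a₀ = ((a₀ : ℝ) + 1) * (1 / 2 : ℝ) ^ a₀ * (1 / 2 : ℝ) ^ a₀ := by rw [e, mul_assoc]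
      _ ≤ 1 * (1 / 2 : ℝ) ^ a₀ := mul_le_mul_of_nonneg_right h1 hh2
      _ = (1 / 2 : ℝ) ^ a₀ := one_mul _
  have h := card_filter_cr_le_le hU (m := a₀) hyp
  have hPM : (0 : ℝ) ≤ ((perfectMatchings S).card : ℝ) := Nat.cast_nonneg _
  exact h.trans (mul_le_mul_of_nonneg_right hq hPM)

/-- **UPPER TAIL, explicit, for a balanced block** `|U| = |S ∖ U| = h`: if `9(a₀ + 1) ≤ h`, then
`#{M ∈ PM(S) : h ≤ cr(U,M) + a₀} ≤ 2^{−a₀}·#PM(S)` — perfect matchings all but at most `a₀` of whose `U`-vertices are matched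
ACROSS (so that both same-side edge classes have `≤ a₀/2` edges) are an exponentially small fraction. (`ρ = 1/4`, `m = a₀ + 1`,
`L = h − 3a₀ − 2`: for `b ≥ L`, `(h − b)² ≤ (3a₀+2)² ≤ ¼(b+1)(b+2)`; the `a₀ + 1` classes `h − a₀ ≤ b ≤ h` each cost `4^{−(a₀+1)}`.)
[cite: Rothvoss2017, §2 (PDF p. 5)] [folklore] -/
theorem card_filter_card_le_cr_add_le_half_pow {S U : Finset V} (hU : U ⊆ S) {a₀ : ℕ}
    (hbal : (S \ U).card = U.card) (hh : 9 * (a₀ + 1) ≤ U.card) :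
    ((((perfectMatchings S).filter fun M => U.card ≤ (M.filter fun e => cutCount U e = 1).card + a₀).card : ℕ) : ℝ) ≤
      (1 / 2 : ℝ) ^ a₀ * ((perfectMatchings S).card : ℝ) := by
  -- the upper hypothesis with `ρ = 1/4` from `L = |U| − 3a₀ − 2` on
  have hyp : ∀ b : ℕ, U.card - 3 * a₀ - 2 ≤ b → b + 2 ≤ U.card → b + 2 ≤ (S \ U).card →
      ((U.card - b : ℕ) : ℝ) * (((S \ U).card - b : ℕ) : ℝ) ≤ (1 / 4 : ℝ) * (((b : ℝ) + 1) * ((b : ℝ) + 2)) := by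
    intro b hb _ _
    rw [hbal]
    have h1 : U.card - b ≤ 3 * a₀ + 2 := by omega
    have h3 : 2 * (3 * a₀ + 2) ≤ b + 1 := by omega
    have h1R : ((U.card - b : ℕ) : ℝ) ≤ 3 * (a₀ : ℝ) + 2 := by exact_mod_cast h1
    have h3R : (2 : ℝ) * (3 * (a₀ : ℝ) + 2) ≤ (b : ℝ) + 1 := by exact_mod_cast h3
    have h0 : (0 : ℝ) ≤ ((U.card - b : ℕ) : ℝ) := Nat.cast_nonneg _
    have hsq : ((U.card - b : ℕ) : ℝ) * ((U.card - b : ℕ) : ℝ) ≤ (3 * (a₀ : ℝ) + 2) * (3 * (a₀ : ℝ) + 2) :=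
      mul_le_mul h1R h1R h0 (by positivity)
    have hb1 : (2 : ℝ) * (3 * (a₀ : ℝ) + 2) ≤ (b : ℝ) + 2 := by linarith
    have hprod : (2 * (3 * (a₀ : ℝ) + 2)) * (2 * (3 * (a₀ : ℝ) + 2)) ≤ ((b : ℝ) + 1) * ((b : ℝ) + 2) :=
      mul_le_mul h3R hb1 (by positivity) (by positivity)
    nlinarith
  -- every class `b ≥ |U| − a₀` costs at most `4^{−(a₀+1)}·#PM`
  have hclass : ∀ b : ℕ, U.card - a₀ ≤ b →
      ((((perfectMatchings S).filter fun M => (M.filter fun e => cutCount U e = 1).card = b).card : ℕ) : ℝ) ≤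
        (1 / 4 : ℝ) ^ (a₀ + 1) * ((perfectMatchings S).card : ℝ) := by
    intro b hb
    have e : b - 2 * (a₀ + 1) + 2 * (a₀ + 1) = b := by omega
    have step := card_cr_add_le_pow_mul hU (by norm_num : (0 : ℝ) ≤ 1 / 4) hyp (a₀ + 1) (b - 2 * (a₀ + 1))
      (by omega)
    rw [e] at step
    exact step.trans (mul_le_mul_of_nonneg_left (by exact_mod_cast card_cr_le_card _) (by positivity))
  -- rewrite the event and sum over the `a₀ + 1` classes `|U| − a₀ ≤ b ≤ |U|`
  set s := (perfectMatchings S).filter fun M => U.card ≤ (M.filter fun e => cutCount U e = 1).card + a₀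
    with hs_def
  have hfib : s.card = ∑ b ∈ Icc (U.card - a₀) U.card,
      (s.filter fun M => (M.filter fun e => cutCount U e = 1).card = b).card :=
    card_eq_sum_card_fiberwise (by
      intro M hM
      rw [mem_coe, hs_def, mem_filter] at hM
      rw [mem_coe, mem_Icc]
      refine ⟨?_, cr_le_card hU hM.1⟩
      dsimp only
      omega)
  rw [hfib]
  push_cast
  have hterm : ∀ b ∈ Icc (U.card - a₀) U.card,
      (((s.filter fun M => (M.filter fun e => cutCount U e = 1).card = b).card : ℕ) : ℝ) ≤
        (1 / 4 : ℝ) ^ (a₀ + 1) * ((perfectMatchings S).card : ℝ) := by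
    intro b hb
    rw [mem_Icc] at hb
    refine le_trans ?_ (hclass b hb.1)
    exact_mod_cast card_le_card (fun M hM => by
      rw [hs_def, mem_filter, mem_filter] at hM
      rw [mem_filter]
      exact ⟨hM.1.1, hM.2⟩)
  -- `(a₀+1)·4^{−a₀} ≤ 2^{−a₀}` (the tree's `Literature.Computability.Cryptography.PowerSeriesFP.succ_mul_quarter_pow_le`, inlined
  -- to keep this file's imports inside the route)
  have hq : ((a₀ : ℝ) + 1) * (1 / 4 : ℝ) ^ a₀ ≤ (1 / 2 : ℝ) ^ a₀ := by
    have h2 : (a₀ : ℝ) + 1 ≤ 2 ^ a₀ := by exact_mod_cast Nat.lt_two_pow_self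
    have e : (1 / 4 : ℝ) ^ a₀ = (1 / 2 : ℝ) ^ a₀ * (1 / 2 : ℝ) ^ a₀ := by rw [← mul_pow]; norm_num
    have hh2 : (0 : ℝ) ≤ (1 / 2 : ℝ) ^ a₀ := by positivity
    have h1 : ((a₀ : ℝ) + 1) * (1 / 2 : ℝ) ^ a₀ ≤ 1 :=
      calc ((a₀ : ℝ) + 1) * (1 / 2 : ℝ) ^ a₀ ≤ 2 ^ a₀ * (1 / 2 : ℝ) ^ a₀ := mul_le_mul_of_nonneg_right h2 hh2
        _ = 1 := by rw [← mul_pow]; norm_num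
    calc ((a₀ : ℝ) + 1) * (1 / 4 : ℝ) ^ a₀ = ((a₀ : ℝ) + 1) * (1 / 2 : ℝ) ^ a₀ * (1 / 2 : ℝ) ^ a₀ := by rw [e, mul_assoc]
      _ ≤ 1 * (1 / 2 : ℝ) ^ a₀ := mul_le_mul_of_nonneg_right h1 hh2
      _ = (1 / 2 : ℝ) ^ a₀ := one_mul _
  have hPM : (0 : ℝ) ≤ ((perfectMatchings S).card : ℝ) := Nat.cast_nonneg _
  calc ∑ b ∈ Icc (U.card - a₀) U.card,
        (((s.filter fun M => (M.filter fun e => cutCount U e = 1).card = b).card : ℕ) : ℝ)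
      ≤ ∑ b ∈ Icc (U.card - a₀) U.card, (1 / 4 : ℝ) ^ (a₀ + 1) * ((perfectMatchings S).card : ℝ) :=
        sum_le_sum hterm
    _ = ((a₀ : ℝ) + 1) * (1 / 4 : ℝ) ^ (a₀ + 1) * ((perfectMatchings S).card : ℝ) := by
        rw [sum_const, Nat.card_Icc, nsmul_eq_mul]
        have : (U.card + 1 - (U.card - a₀) : ℕ) = a₀ + 1 := by omega
        rw [this]; push_cast; ring
    _ ≤ ((a₀ : ℝ) + 1) * (1 / 4 : ℝ) ^ a₀ * ((perfectMatchings S).card : ℝ) := by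
        apply mul_le_mul_of_nonneg_right _ hPM
        apply mul_le_mul_of_nonneg_left _ (by positivity)
        have h4 : (0 : ℝ) ≤ (1 / 4 : ℝ) ^ a₀ := by positivity
        rw [pow_succ]
        nlinarith
    _ ≤ (1 / 2 : ℝ) ^ a₀ * ((perfectMatchings S).card : ℝ) := mul_le_mul_of_nonneg_right hq hPM

end General

/-! ### §6 The `PMatch n` forms (Rothvoß's vocabulary) -/

variable {n : ℕ}

/-- For a set of pairs `M`, the number of its elements `Crosses`-ing `H` is the `cutCount = 1` count. [folklore] -/
theorem card_filter_crosses_eq (H : Finset (Fin n)) (M : Finset (Sym2 (Fin n))) :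
    (M.filter (Crosses H)).card = (M.filter fun e => cutCount H e = 1).card := by
  congr 1
  exact filter_congr fun e _ => crosses_iff_cutCount_eq_one H e

/-- `|PMatch n| = #PM(Fin n)`. [folklore] -/
theorem card_pmatch_eq_card_perfectMatchings :
    Fintype.card (PMatch n) = (perfectMatchings (univ : Finset (Fin n))).card := by
  have h := card_filter_pmatch (n := n) (fun _ => True)
  rw [filter_true_of_mem (fun _ _ => trivial), filter_true_of_mem (fun _ _ => trivial), card_univ] at h
  exact h

/-- **Few `H`-crossing edges are exponentially rare (matchings of `K_n`).** For `H ⊆ Fin n` with `9a₀ + 1 ≤ |H|` and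
`9a₀ + 1 ≤ n − |H|`: `#{M : PMatch n | #{e ∈ M crossing H} ≤ a₀} ≤ 2^{−a₀}·|PMatch n|`. [cite: Rothvoss2017, §2 (PDF p. 5)] [folklore] -/
theorem card_pmatch_crosses_le_le (H : Finset (Fin n)) {a₀ : ℕ} (hh : 9 * a₀ + 1 ≤ H.card)
    (hh' : 9 * a₀ + 1 ≤ n - H.card) :
    (((univ.filter fun M : PMatch n => (M.1.filter (Crosses H)).card ≤ a₀).card : ℕ) : ℝ) ≤
      (1 / 2 : ℝ) ^ a₀ * (Fintype.card (PMatch n) : ℝ) := by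
  have hc : (univ \ H).card = n - H.card := by rw [card_univ_sdiff, Fintype.card_fin]
  have h1 := card_filter_cr_le_le_half_pow (subset_univ H) (a₀ := a₀) hh (by rw [hc]; exact hh')
  have key : (univ.filter fun M : PMatch n => (M.1.filter (Crosses H)).card ≤ a₀).card =
      ((perfectMatchings (univ : Finset (Fin n))).filter fun M =>
        (M.filter fun e => cutCount H e = 1).card ≤ a₀).card := by
    rw [← card_filter_pmatch (fun M => (M.filter fun e => cutCount H e = 1).card ≤ a₀)]
    congr 1
    exact filter_congr fun M _ => by rw [card_filter_crosses_eq]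
  rw [key, card_pmatch_eq_card_perfectMatchings]
  exact h1

/-- **Few NON-crossing edges are exponentially rare, for a balanced block** `|H| = n − |H|`: if `9(a₀+1) ≤ |H|` then
`#{M : PMatch n | |H| ≤ #{e ∈ M crossing H} + a₀} ≤ 2^{−a₀}·|PMatch n|`. [cite: Rothvoss2017, §2 (PDF p. 5)] [folklore] -/
theorem card_pmatch_le_crosses_le (H : Finset (Fin n)) {a₀ : ℕ} (hbal : n - H.card = H.card)
    (hh : 9 * (a₀ + 1) ≤ H.card) :
    (((univ.filter fun M : PMatch n => H.card ≤ (M.1.filter (Crosses H)).card + a₀).card : ℕ) : ℝ) ≤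
      (1 / 2 : ℝ) ^ a₀ * (Fintype.card (PMatch n) : ℝ) := by
  have hc : (univ \ H).card = n - H.card := by rw [card_univ_sdiff, Fintype.card_fin]
  have h1 := card_filter_card_le_cr_add_le_half_pow (subset_univ H) (a₀ := a₀) (by rw [hc, hbal]) hh
  have key : (univ.filter fun M : PMatch n => H.card ≤ (M.1.filter (Crosses H)).card + a₀).card =
      ((perfectMatchings (univ : Finset (Fin n))).filter fun M =>
        H.card ≤ (M.filter fun e => cutCount H e = 1).card + a₀).card := by
    rw [← card_filter_pmatch (fun M => H.card ≤ (M.filter fun e => cutCount H e = 1).card + a₀)]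
    congr 1
    exact filter_congr fun M _ => by rw [card_filter_crosses_eq]
  rw [key, card_pmatch_eq_card_perfectMatchings]
  exact h1

/-! ### §7 (v2 append) The upper tail for NEAR-balanced blocks -/

section NearBalanced

variable {V : Type*} [DecidableEq V]

/-- **UPPER TAIL, explicit, for a near-balanced block** `|S ∖ U| = |U| + e` (`e ≥ 0`): if `9(a₀+1) + 2e ≤ |U|` then
`#{M ∈ PM(S) : |U| ≤ cr(U,M) + a₀} ≤ 2^{−a₀}·#PM(S)`. For `e > 2a₀` the event «both same-side classes `≤ a₀/2`» is empty anyway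
(`d = a + e/2`), so together with the balanced case this covers every block for which the upper exceptional set is needed.
(`ρ = 1/4`, `m = a₀+1`, `L = |U| − 3a₀ − 2`: for `b ≥ L`, `(h−b)(h'−b) ≤ (3a₀+2)(3a₀+2+e) ≤ ¼(b+1)(b+2)`.)
[cite: Rothvoss2017, §2 (PDF p. 5)] [folklore] -/
theorem card_filter_card_le_cr_add_le_half_pow_near {S U : Finset V} (hU : U ⊆ S) {a₀ : ℕ}
    (hle : U.card ≤ (S \ U).card) (hh : 9 * (a₀ + 1) + 2 * ((S \ U).card - U.card) ≤ U.card) :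
    ((((perfectMatchings S).filter fun M => U.card ≤ (M.filter fun e => cutCount U e = 1).card + a₀).card : ℕ) : ℝ) ≤
      (1 / 2 : ℝ) ^ a₀ * ((perfectMatchings S).card : ℝ) := by
  -- the upper hypothesis with `ρ = 1/4` from `L = |U| − 3a₀ − 2` on
  have hyp : ∀ b : ℕ, U.card - 3 * a₀ - 2 ≤ b → b + 2 ≤ U.card → b + 2 ≤ (S \ U).card →
      ((U.card - b : ℕ) : ℝ) * (((S \ U).card - b : ℕ) : ℝ) ≤ (1 / 4 : ℝ) * (((b : ℝ) + 1) * ((b : ℝ) + 2)) := by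
    intro b hb _ _
    have h1 : U.card - b ≤ 3 * a₀ + 2 := by omega
    have h1' : (S \ U).card - b ≤ 3 * a₀ + 2 + ((S \ U).card - U.card) := by omega
    have h3 : 2 * (3 * a₀ + 2 + ((S \ U).card - U.card)) ≤ b + 1 := by omega
    set e := (S \ U).card - U.card with he_def
    have h1R : ((U.card - b : ℕ) : ℝ) ≤ 3 * (a₀ : ℝ) + 2 + (e : ℝ) := by
      have : ((U.card - b : ℕ) : ℝ) ≤ ((3 * a₀ + 2 : ℕ) : ℝ) := by exact_mod_cast h1
      have h0e : (0 : ℝ) ≤ (e : ℝ) := Nat.cast_nonneg e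
      push_cast at this; linarith
    have h1R' : (((S \ U).card - b : ℕ) : ℝ) ≤ 3 * (a₀ : ℝ) + 2 + (e : ℝ) := by exact_mod_cast h1'
    have h3R : (2 : ℝ) * (3 * (a₀ : ℝ) + 2 + (e : ℝ)) ≤ (b : ℝ) + 1 := by exact_mod_cast h3
    have h0 : (0 : ℝ) ≤ ((U.card - b : ℕ) : ℝ) := Nat.cast_nonneg _
    have hsq : ((U.card - b : ℕ) : ℝ) * (((S \ U).card - b : ℕ) : ℝ) ≤
        (3 * (a₀ : ℝ) + 2 + (e : ℝ)) * (3 * (a₀ : ℝ) + 2 + (e : ℝ)) :=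
      mul_le_mul h1R h1R' (Nat.cast_nonneg _) (by positivity)
    have hb1 : (2 : ℝ) * (3 * (a₀ : ℝ) + 2 + (e : ℝ)) ≤ (b : ℝ) + 2 := by linarith
    have hprod : (2 * (3 * (a₀ : ℝ) + 2 + (e : ℝ))) * (2 * (3 * (a₀ : ℝ) + 2 + (e : ℝ))) ≤ ((b : ℝ) + 1) * ((b : ℝ) + 2) :=
      mul_le_mul h3R hb1 (by positivity) (by positivity)
    nlinarith
  -- every class `b ≥ |U| − a₀` costs at most `4^{−(a₀+1)}·#PM`
  have hclass : ∀ b : ℕ, U.card - a₀ ≤ b →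
      ((((perfectMatchings S).filter fun M => (M.filter fun e => cutCount U e = 1).card = b).card : ℕ) : ℝ) ≤
        (1 / 4 : ℝ) ^ (a₀ + 1) * ((perfectMatchings S).card : ℝ) := by
    intro b hb
    have e : b - 2 * (a₀ + 1) + 2 * (a₀ + 1) = b := by omega
    have step := card_cr_add_le_pow_mul hU (by norm_num : (0 : ℝ) ≤ 1 / 4) hyp (a₀ + 1) (b - 2 * (a₀ + 1))
      (by omega)
    rw [e] at step
    exact step.trans (mul_le_mul_of_nonneg_left (by exact_mod_cast card_cr_le_card _) (by positivity))
  -- rewrite the event and sum over the `a₀ + 1` classes `|U| − a₀ ≤ b ≤ |U|`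
  set s := (perfectMatchings S).filter fun M => U.card ≤ (M.filter fun e => cutCount U e = 1).card + a₀
    with hs_def
  have hfib : s.card = ∑ b ∈ Icc (U.card - a₀) U.card,
      (s.filter fun M => (M.filter fun e => cutCount U e = 1).card = b).card :=
    card_eq_sum_card_fiberwise (by
      intro M hM
      rw [mem_coe, hs_def, mem_filter] at hM
      rw [mem_coe, mem_Icc]
      refine ⟨?_, cr_le_card hU hM.1⟩
      dsimp only
      omega)
  rw [hfib]
  push_cast
  have hterm : ∀ b ∈ Icc (U.card - a₀) U.card,
      (((s.filter fun M => (M.filter fun e => cutCount U e = 1).card = b).card : ℕ) : ℝ) ≤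
        (1 / 4 : ℝ) ^ (a₀ + 1) * ((perfectMatchings S).card : ℝ) := by
    intro b hb
    rw [mem_Icc] at hb
    refine le_trans ?_ (hclass b hb.1)
    exact_mod_cast card_le_card (fun M hM => by
      rw [hs_def, mem_filter, mem_filter] at hM
      rw [mem_filter]
      exact ⟨hM.1.1, hM.2⟩)
  -- `(a₀+1)·4^{−a₀} ≤ 2^{−a₀}` (the tree's `Literature.Computability.Cryptography.PowerSeriesFP.succ_mul_quarter_pow_le`, inlined
  -- to keep this file's imports inside the route)
  have hq : ((a₀ : ℝ) + 1) * (1 / 4 : ℝ) ^ a₀ ≤ (1 / 2 : ℝ) ^ a₀ := by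
    have h2 : (a₀ : ℝ) + 1 ≤ 2 ^ a₀ := by exact_mod_cast Nat.lt_two_pow_self
    have e : (1 / 4 : ℝ) ^ a₀ = (1 / 2 : ℝ) ^ a₀ * (1 / 2 : ℝ) ^ a₀ := by rw [← mul_pow]; norm_num
    have hh2 : (0 : ℝ) ≤ (1 / 2 : ℝ) ^ a₀ := by positivity
    have h1 : ((a₀ : ℝ) + 1) * (1 / 2 : ℝ) ^ a₀ ≤ 1 :=
      calc ((a₀ : ℝ) + 1) * (1 / 2 : ℝ) ^ a₀ ≤ 2 ^ a₀ * (1 / 2 : ℝ) ^ a₀ := mul_le_mul_of_nonneg_right h2 hh2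
        _ = 1 := by rw [← mul_pow]; norm_num
    calc ((a₀ : ℝ) + 1) * (1 / 4 : ℝ) ^ a₀ = ((a₀ : ℝ) + 1) * (1 / 2 : ℝ) ^ a₀ * (1 / 2 : ℝ) ^ a₀ := by rw [e, mul_assoc]
      _ ≤ 1 * (1 / 2 : ℝ) ^ a₀ := mul_le_mul_of_nonneg_right h1 hh2
      _ = (1 / 2 : ℝ) ^ a₀ := one_mul _
  have hPM : (0 : ℝ) ≤ ((perfectMatchings S).card : ℝ) := Nat.cast_nonneg _
  calc ∑ b ∈ Icc (U.card - a₀) U.card,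
        (((s.filter fun M => (M.filter fun e => cutCount U e = 1).card = b).card : ℕ) : ℝ)
      ≤ ∑ b ∈ Icc (U.card - a₀) U.card, (1 / 4 : ℝ) ^ (a₀ + 1) * ((perfectMatchings S).card : ℝ) :=
        sum_le_sum hterm
    _ = ((a₀ : ℝ) + 1) * (1 / 4 : ℝ) ^ (a₀ + 1) * ((perfectMatchings S).card : ℝ) := by
        rw [sum_const, Nat.card_Icc, nsmul_eq_mul]
        have : (U.card + 1 - (U.card - a₀) : ℕ) = a₀ + 1 := by omega
        rw [this]; push_cast; ring
    _ ≤ ((a₀ : ℝ) + 1) * (1 / 4 : ℝ) ^ a₀ * ((perfectMatchings S).card : ℝ) := by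
        apply mul_le_mul_of_nonneg_right _ hPM
        apply mul_le_mul_of_nonneg_left _ (by positivity)
        have h4 : (0 : ℝ) ≤ (1 / 4 : ℝ) ^ a₀ := by positivity
        rw [pow_succ]
        nlinarith
    _ ≤ (1 / 2 : ℝ) ^ a₀ * ((perfectMatchings S).card : ℝ) := mul_le_mul_of_nonneg_right hq hPM

end NearBalanced

/-- **Few NON-crossing edges are exponentially rare, near-balanced block of `K_n`**: for `H ⊆ Fin n` with `|H| ≤ n − |H|` and
`9(a₀+1) + 2(n − 2|H|) ≤ |H|`: `#{M : PMatch n | |H| ≤ #{e ∈ M crossing H} + a₀} ≤ 2^{−a₀}·|PMatch n|`.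
[cite: Rothvoss2017, §2 (PDF p. 5)] [folklore] -/
theorem card_pmatch_le_crosses_le_near (H : Finset (Fin n)) {a₀ : ℕ} (hle : H.card ≤ n - H.card)
    (hh : 9 * (a₀ + 1) + 2 * (n - H.card - H.card) ≤ H.card) :
    (((univ.filter fun M : PMatch n => H.card ≤ (M.1.filter (Crosses H)).card + a₀).card : ℕ) : ℝ) ≤
      (1 / 2 : ℝ) ^ a₀ * (Fintype.card (PMatch n) : ℝ) := by
  have hc : (univ \ H).card = n - H.card := by rw [card_univ_sdiff, Fintype.card_fin]
  have h1 := card_filter_card_le_cr_add_le_half_pow_near (subset_univ H) (a₀ := a₀) (by rw [hc]; exact hle)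
    (by rw [hc]; exact hh)
  have key : (univ.filter fun M : PMatch n => H.card ≤ (M.1.filter (Crosses H)).card + a₀).card =
      ((perfectMatchings (univ : Finset (Fin n))).filter fun M =>
        H.card ≤ (M.filter fun e => cutCount H e = 1).card + a₀).card := by
    rw [← card_filter_pmatch (fun M => H.card ≤ (M.filter fun e => cutCount H e = 1).card + a₀)]
    congr 1
    exact filter_congr fun M _ => by rw [card_filter_crosses_eq]
  rw [key, card_pmatch_eq_card_perfectMatchings]
  exact h1

end Summit.PneNP.PneNP.Theorems.ChebyshevTracialDesignCrossingCountTailsExplicit
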